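import Literature.MathematicalPhysics.QuantumManyBody.BoseGasThermodynamicLimitRuelle
import Literature.MathematicalPhysics.QuantumManyBody.JelliumBoseGasCondensateDilation
import HarnessLib

/-!
# Route `BECTangentRigidity`, crux `RigidMomentumBound` (stmt-AtomisticToContinuum-13034):
# stub `stub_displacementSoftness_of_contactSoftness` — contact softness ⟹ displacement softness

SIDE-RESULT of the registered line (soft-core branch of S4). *Displacement softness* of a pair
potential `v` says: enlarging the thermodynamic box `L_N = (N/ρ)^{1/3}` by the factor `1 + κ/N`
lowers the Dirichlet ground-state energy by at most `ε N / L_N²`, eventually in `N`, for all small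
densities and all `ε, κ > 0`. *Contact softness* says: at the fixed (enlarged) box
`L' = (1 + κ/N) L_N`, replacing `v` by the fattened potential `v_s = s⁻² v(·/s)`
(`scalePotential s v`, `s = 1 + κ/N`) raises the energy by at most `ε N / L_N²`.

By the exact dilation covariance `E₀(v_s; N, sL) = s⁻² E₀(v; N, L)`
(`JelliumBoseGas.groundStateEnergy_dilate`, LSSY 2005 Ch. 5, footnote to (5.3)) the two are
equivalent once the energy is `O(N)` (hypothesis S1): with `s = 1 + κ/N`, `L = L_N`,
`E₀(v;N,L) = s² E₀(v_s;N,sL) ≤ s² (E₀(v;N,sL) + εN/(8L²))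
  ≤ E₀(v;N,sL) + (s² - 1) C N + s² εN/(8L²) ≤ E₀(v;N,sL) + εN/L²`
eventually, since `(s² - 1) C N ≤ 3κC` for `N ≥ κ`, `s² ≤ 4`, and `N/L² = ρ L_N → ∞`.

References: Lieb–Seiringer–Solovej–Yngvason, *The Mathematics of the Bose Gas and its
Condensation* (2005), Ch. 5 (scaling footnote to (5.3)); the covariance itself is the tree's
`groundStateEnergy_dilate`.
-/

noncomputable section

namespace Summit.AtomisticToContinuum.BoseEinsteinCondensation.Theorems.RigidMomentumBound

open MeasureTheory Filter
open scoped ENNReal NNReal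
open Literature.MathematicalPhysics.QuantumManyBody.BoseGas

/-- **Dilation reduction.** If fattening the potential at fixed box `sL` costs at most `η`, then
compressing the box from `sL` to `L` costs at most the factor `s²` on top:
`E₀(v; N, L) ≤ s² (E₀(v; N, sL) + η)`. -/
theorem groundStateEnergy_le_of_scalePotential (v : ℝ → ℝ≥0∞) (N : ℕ) (L : ℝ) {s : ℝ}
    (hs : 0 < s) {η : ℝ≥0∞}
    (h : groundStateEnergy (scalePotential s v) N (s * L) ≤ groundStateEnergy v N (s * L) + η) :
    groundStateEnergy v N L ≤ ENNReal.ofReal (s ^ 2) * (groundStateEnergy v N (s * L) + η) := by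
  have hd := Literature.MathematicalPhysics.QuantumManyBody.JelliumBoseGas.groundStateEnergy_dilate
    v N L hs
  have hs2 : (0 : ℝ) < s ^ 2 := pow_pos hs 2
  have hone : ENNReal.ofReal (s ^ 2) * ENNReal.ofReal (s ^ 2)⁻¹ = 1 := by
    rw [← ENNReal.ofReal_mul hs2.le, mul_inv_cancel₀ hs2.ne', ENNReal.ofReal_one]
  calc groundStateEnergy v N L
      = ENNReal.ofReal (s ^ 2) * (ENNReal.ofReal (s ^ 2)⁻¹ * groundStateEnergy v N L) := by
        rw [← mul_assoc, hone, one_mul]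
    _ = ENNReal.ofReal (s ^ 2) * groundStateEnergy (scalePotential s v) N (s * L) := by rw [hd]
    _ ≤ ENNReal.ofReal (s ^ 2) * (groundStateEnergy v N (s * L) + η) := by gcongr

/-- `N / L_N² = ρ L_N` for `N > 0`. -/
theorem div_sideLength_sq {ρ : ℝ} (hρ : 0 < ρ) {N : ℕ} (hN : 0 < N) :
    (N : ℝ) / sideLength ρ N ^ 2 = ρ * sideLength ρ N := by
  have hL : 0 < sideLength ρ N := Real.rpow_pos_of_pos (div_pos (Nat.cast_pos.2 hN) hρ) _
  have h3 := sideLength_pow_three hρ N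
  have hN' : (N : ℝ) = ρ * sideLength ρ N ^ 3 := by
    rw [h3]; field_simp
  rw [hN']
  field_simp

/-- **Stub `stub_displacementSoftness_of_contactSoftness`: contact softness + linearity of the
energy ⟹ displacement softness.** For a pair potential `v` with `E₀(v; N, L_N) ≤ C N` at small
densities (S1) and the contact-softness bound
`E₀(v_s; N, sL_N) ≤ E₀(v; N, sL_N) + εN/L_N²` (`s = 1 + κ/N`, all small `ρ`, all `ε, κ > 0`,
eventually in `N`), the box-enlargement bound `E₀(v; N, L_N) ≤ E₀(v; N, sL_N) + εN/L_N²` holds in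
the same regime. Proof: dilation covariance (`groundStateEnergy_le_of_scalePotential`) with
`ε/8`, then `(s² - 1) C N ≤ 3κC ≤ (ε/2) ρ L_N` and `s² ε/8 ≤ ε/2` eventually. [folklore] -/
theorem stub_displacementSoftness_of_contactSoftness :
    ∀ (v : ℝ → ℝ≥0∞),
      (∃ ρ₁ : ℝ, 0 < ρ₁ ∧ ∀ ρ : ℝ, 0 < ρ → ρ < ρ₁ → ∃ C : ℝ, 0 ≤ C ∧ ∀ᶠ N : ℕ in atTop,
        groundStateEnergy v N (sideLength ρ N) ≤ ENNReal.ofReal (C * N)) →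
      (∃ ρ₂ : ℝ, 0 < ρ₂ ∧ ∀ ρ : ℝ, 0 < ρ → ρ < ρ₂ → ∀ ε : ℝ, 0 < ε → ∀ κ : ℝ, 0 < κ →
        ∀ᶠ N : ℕ in atTop,
          groundStateEnergy (scalePotential (1 + κ / N) v) N ((1 + κ / N) * sideLength ρ N) ≤
            groundStateEnergy v N ((1 + κ / N) * sideLength ρ N) +
              ENNReal.ofReal (ε * N / sideLength ρ N ^ 2)) →
      ∃ ρ₀ : ℝ, 0 < ρ₀ ∧ ∀ ρ : ℝ, 0 < ρ → ρ < ρ₀ →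
        ∀ ε : ℝ, 0 < ε → ∀ κ : ℝ, 0 < κ → ∀ᶠ N : ℕ in atTop,
          groundStateEnergy v N (sideLength ρ N) ≤
            groundStateEnergy v N ((1 + κ / N) * sideLength ρ N) +
              ENNReal.ofReal (ε * N / sideLength ρ N ^ 2) := by
  intro v hlin hcs
  obtain ⟨ρ₁, hρ₁, h₁⟩ := hlin
  obtain ⟨ρ₂, hρ₂, h₂⟩ := hcs
  refine ⟨min ρ₁ ρ₂, lt_min hρ₁ hρ₂, fun ρ hρ hρlt ε hε κ hκ => ?_⟩
  obtain ⟨C, hC, hE⟩ := h₁ ρ hρ (hρlt.trans_le (min_le_left _ _))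
  have hS := h₂ ρ hρ (hρlt.trans_le (min_le_right _ _)) (ε / 8) (by positivity) κ hκ
  have hT : Tendsto (fun N : ℕ => ρ * sideLength ρ N) atTop atTop :=
    (tendsto_sideLength_atTop hρ).const_mul_atTop hρ
  have hκN : ∀ᶠ N : ℕ in atTop, κ ≤ (N : ℝ) := tendsto_natCast_atTop_atTop.eventually_ge_atTop κ
  filter_upwards [hE, hS, eventually_gt_atTop 0, hT.eventually_ge_atTop (6 * κ * C / ε), hκN] with
    N hN₁ hN₂ hN0 hNA hNκ
  have hNpos : (0 : ℝ) < N := Nat.cast_pos.2 hN0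
  set L := sideLength ρ N with hLdef
  have hLpos : 0 < L := Real.rpow_pos_of_pos (div_pos hNpos hρ) _
  set s : ℝ := 1 + κ / N with hsdef
  have hs1 : 1 ≤ s := le_add_of_nonneg_right (by positivity)
  have hspos : 0 < s := one_pos.trans_le hs1
  have hs2 : s ≤ 2 := by
    rw [hsdef]
    have : κ / N ≤ 1 := (div_le_one hNpos).2 hNκ
    linarith
  -- `A = N / L² = ρ L`
  have hA : (N : ℝ) / L ^ 2 = ρ * L := div_sideLength_sq hρ hN0
  have hApos : 0 < ρ * L := mul_pos hρ hLpos
  -- monotonicity: `E₀(v; N, sL) ≤ E₀(v; N, L) ≤ C N`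
  have hLsL : L ≤ s * L := le_mul_of_one_le_left hLpos.le hs1
  have hEs : groundStateEnergy v N (s * L) ≤ ENNReal.ofReal (C * N) :=
    (groundStateEnergy_anti v N hLsL).trans hN₁
  -- the reduction
  have hred := groundStateEnergy_le_of_scalePotential v N L hspos hN₂
  -- bookkeeping: `s² (E + η) = E + (s² - 1) E + s² η`
  have hsq : ENNReal.ofReal (s ^ 2) = 1 + ENNReal.ofReal (s ^ 2 - 1) := by
    rw [← ENNReal.ofReal_one, ← ENNReal.ofReal_add zero_le_one (by nlinarith)]
    congr 1; ring
  have hη : (0 : ℝ) ≤ ε / 8 * N / L ^ 2 := by positivity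
  calc groundStateEnergy v N L
      ≤ ENNReal.ofReal (s ^ 2) *
          (groundStateEnergy v N (s * L) + ENNReal.ofReal (ε / 8 * N / L ^ 2)) := hred
    _ = groundStateEnergy v N (s * L) +
          (ENNReal.ofReal (s ^ 2 - 1) * groundStateEnergy v N (s * L) +
            ENNReal.ofReal (s ^ 2) * ENNReal.ofReal (ε / 8 * N / L ^ 2)) := by
        rw [hsq]; ring
    _ ≤ groundStateEnergy v N (s * L) +
          (ENNReal.ofReal (s ^ 2 - 1) * ENNReal.ofReal (C * N) +
            ENNReal.ofReal (s ^ 2) * ENNReal.ofReal (ε / 8 * N / L ^ 2)) := by gcongr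
    _ = groundStateEnergy v N (s * L) +
          ENNReal.ofReal ((s ^ 2 - 1) * (C * N) + s ^ 2 * (ε / 8 * N / L ^ 2)) := by
        rw [← ENNReal.ofReal_mul (by nlinarith), ← ENNReal.ofReal_mul (by positivity),
          ← ENNReal.ofReal_add (mul_nonneg (by nlinarith) (by positivity)) (by positivity)]
    _ ≤ groundStateEnergy v N (s * L) + ENNReal.ofReal (ε * N / L ^ 2) := by
        gcongr groundStateEnergy v N (s * L) + ENNReal.ofReal ?_
        rw [mul_div_assoc, mul_div_assoc, hA]
        -- real inequality: `(s²-1) C N + s² (ε/8) ρL ≤ ε ρ L`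
        have h1 : (s ^ 2 - 1) * (C * N) ≤ 3 * κ * C := by
          have hsq' : s ^ 2 - 1 = (2 * κ + κ * (κ / N)) / N := by
            rw [hsdef]; field_simp; ring
          rw [hsq']
          have hκN' : κ * (κ / N) ≤ κ * 1 :=
            mul_le_mul_of_nonneg_left ((div_le_one hNpos).2 hNκ) hκ.le
          have : (2 * κ + κ * (κ / N)) / N * (C * N) = (2 * κ + κ * (κ / N)) * C := by
            field_simp
          rw [this]
          nlinarith
        have h2 : s ^ 2 * (ε / 8 * (ρ * L)) ≤ ε / 2 * (ρ * L) := by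
          have : s ^ 2 ≤ 4 := by nlinarith
          nlinarith [mul_pos hε hApos]
        have h3 : 3 * κ * C ≤ ε / 2 * (ρ * L) := by
          have := hNA
          rw [div_le_iff₀ hε] at this
          nlinarith
        linarith

end Summit.AtomisticToContinuum.BoseEinsteinCondensation.Theorems.RigidMomentumBound

end
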